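import Mathlib
import Literature.Probability.RandomPlanarGeometry.ConformalRectangleProofs
import HarnessLib

/-!
# Boundary charts of Jordan domains and cross-ratio rigidity on an interval

Topic `Literature/Probability/RandomPlanarGeometry` (input of the rigidity step of crux
stmt-CriticalPhenomena-0698, `Summits/CriticalPhenomena/CardyFormulaZ2`).

* `JordanDomain.exists_boundaryChart`: for a Jordan domain `Ω` and a base parameter `t₁`, a
  conformal chart `φ : ℍ → Ω` sending `∞` to the boundary point `p₁ = Ω.boundary t₁`, together
  with its real boundary correspondence `g` (`φ` has boundary value `Ω.boundary t` at the real
  point `g t` whenever `Ω.boundary t ≠ p₁`), the boundary behaviour of `φ⁻¹`, injectivity of `g`,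
  and `|g t| → ∞` as `Ω.boundary t → p₁`. This is the construction inside the tree's
  `MarkedDomain.exists_isUniformizing_of_disc` (Riemann map of the disc,
  `exists_conformalEquiv_ball_holds`; Carathéodory's theorem in disc form,
  `JordanDomain.exists_continuousOn_extension_holds`, Pommerenke (1992) Thm. 2.6; a rotation of
  the disc and the Cayley transform), with more conclusions recorded.
* `affine_of_crossRatio_eq` (real analysis): if two real functions `g, g'`, injective on
  `[0, t₁)` and unbounded at `t₁⁻`, have the same Cardy cross-ratio on every increasing 4-tuple of
  `[0, t₁)`, then `g' = A g + B` on `[0, t₁)` with `A ≠ 0`: letting the fourth point tend to `t₁`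
  the cross-ratio tends to the 3-point ratio `(x₀ - x₁)/(x₀ - x₂)` (Ahlfors (1979), Ch. 3 §3.1),
  whose invariance is affineness.

## References

* Ch. Pommerenke, *Boundary Behaviour of Conformal Maps* (1992), Thm. 2.6 and Cor. 2.7.
* L. V. Ahlfors, *Complex Analysis*, 3rd ed. (1979), Ch. 3 §3.1, Ch. 6 §1.1.
-/

noncomputable section

open Set Filter Topology Complex Metric
open UpperHalfPlane (upperHalfPlaneSet)

namespace Literature.Probability.RandomPlanarGeometry

/-! ### Boundary charts of a Jordan domain -/

/-- **Boundary chart of a Jordan domain based at `p₁ = Ω.boundary t₁`.** There are a conformal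
equivalence `φ : ℍ → Ω` and a real function `g` such that, writing `p₁ = Ω.boundary t₁`:
(1) `φ` has boundary value `Ω.boundary t` at the real point `g t` whenever `Ω.boundary t ≠ p₁`;
(2) conversely `φ⁻¹ w → g t` as `w → Ω.boundary t` inside `Ω`;
(3) `g` separates boundary points other than `p₁`: `g s = g t` forces `Ω.boundary s = Ω.boundary t`;
(4) `|g t| → ∞` as `t → t₁` through parameters with `Ω.boundary t ≠ p₁`;
(5) `φ → p₁` at infinity and (6) `φ⁻¹ w → ∞` as `w → p₁` inside `Ω`.
Construction: Riemann map `ψ : Ω → 𝔻`, Carathéodory extension `Ψ` of `ψ⁻¹` with inverse `Φ` on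
`∂Ω`, `η = Φ p₁`, `φ = ψ⁻¹ ∘ (η ·) ∘ cayley`, `g t = Re cayley⁻¹ (η⁻¹ Φ (Ω.boundary t))`
(as in the tree's `MarkedDomain.exists_isUniformizing_of_disc`). [cite: PommerenkeBBCM1992, Thm. 2.6 and Cor. 2.7] -/
theorem JordanDomain.exists_boundaryChart (Ω : JordanDomain) (t₁ : ℝ) :
    ∃ (φ : ConformalEquiv upperHalfPlaneSet Ω.carrier) (g : ℝ → ℝ),
      (∀ t, Ω.boundary t ≠ Ω.boundary t₁ → φ.HasBoundaryValue (g t) (Ω.boundary t)) ∧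
      (∀ t, Ω.boundary t ≠ Ω.boundary t₁ →
        Tendsto φ.symm (𝓝[Ω.carrier] (Ω.boundary t)) (𝓝 (g t))) ∧
      (∀ s t, Ω.boundary s ≠ Ω.boundary t₁ → Ω.boundary t ≠ Ω.boundary t₁ → g s = g t →
        Ω.boundary s = Ω.boundary t) ∧
      Tendsto (fun t ↦ |g t|) (𝓝[{t | Ω.boundary t ≠ Ω.boundary t₁}] t₁) atTop ∧
      φ.HasBoundaryValueAtInfty (Ω.boundary t₁) ∧
      Tendsto φ.symm (𝓝[Ω.carrier] (Ω.boundary t₁)) (cocompact ℂ) := by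
  -- Riemann map `ψ : Ω → 𝔻` and the Carathéodory extension `Ψ` of `ψ⁻¹ : 𝔻 → Ω`
  have hsc : IsSimplyConnected Ω.carrier :=
    Complex.isSimplyConnected_of_isPreconnected_frontier Ω.isOpen Ω.isConnected Ω.isBounded
      (Ω.range_boundary ▸ isPreconnected_range Ω.continuous_boundary)
  obtain ⟨ψ⟩ := (exists_conformalEquiv_ball_holds (U := Ω.carrier)) Ω.isOpen hsc Ω.carrier_ne_univ
  obtain ⟨Ψ, hΨc, hΨeq, hbij, hsph⟩ :=
    JordanDomain.exists_continuousOn_extension_holds Ω ψ.symm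
  -- the inverse boundary correspondence `Φ : ∂Ω → ∂𝔻`
  set Φ : ℂ → ℂ := Function.invFunOn Ψ (sphere 0 1) with hΦdef
  have hΦK : MapsTo Φ (frontier Ω.carrier) (sphere 0 1) := hsph.surjOn.mapsTo_invFunOn
  have hΨΦ : ∀ p ∈ frontier Ω.carrier, Ψ (Φ p) = p := fun p hp ↦ hsph.invOn_invFunOn.2 hp
  have hΦc : ContinuousOn Φ (frontier Ω.carrier) :=
    continuousOn_invFunOn_of_isCompact (isCompact_sphere 0 1) (hΨc.mono sphere_subset_closedBall)
      hsph
  have hΦ1 : ∀ p ∈ frontier Ω.carrier, ‖Φ p‖ = 1 := fun p hp ↦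
    mem_sphere_zero_iff_norm.1 (hΦK hp)
  -- the base point `p₁` and the rotation `η`
  set p₁ : ℂ := Ω.boundary t₁ with hp₁
  have hp₁f : p₁ ∈ frontier Ω.carrier := Ω.boundary_mem_frontier t₁
  set η : ℂ := Φ p₁ with hη
  have hη1 : ‖η‖ = 1 := hΦ1 p₁ hp₁f
  have hη0 : η ≠ 0 := norm_ne_zero_iff.1 (by rw [hη1]; exact one_ne_zero)
  -- the rotated inverse Riemann map `ψ₂ = ψ⁻¹ ∘ (η ·)` and its extension `Ψ₂ = Ψ ∘ (η ·)`
  set ψ₂ : ConformalEquiv (ball (0 : ℂ) 1) Ω.carrier := (rotBall η hη1).trans ψ.symm with hψ₂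
  set Ψ₂ : ℂ → ℂ := fun w ↦ Ψ (η * w) with hΨ₂
  have hrot : MapsTo (fun w : ℂ ↦ η * w) (closedBall 0 1) (closedBall 0 1) := fun w hw ↦ by
    rw [mem_closedBall_zero_iff] at hw ⊢
    rwa [norm_mul, hη1, one_mul]
  have hΨ₂c : ContinuousOn Ψ₂ (closedBall 0 1) :=
    hΨc.comp (continuous_const_mul η).continuousOn hrot
  have hΨ₂eq : EqOn Ψ₂ ψ₂ (ball 0 1) := fun w hw ↦ hΨeq ((rotBall η hη1).mapsTo hw)
  have hΨ₂inj : InjOn Ψ₂ (closedBall 0 1) := by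
    intro w hw w' hw' h
    have := hbij.injOn (hrot hw) (hrot hw') h
    exact mul_left_cancel₀ hη0 this
  -- the chart `φ = ψ₂ ∘ cayley : ℍ → Ω`
  set φ : ConformalEquiv upperHalfPlaneSet Ω.carrier := cayley.trans ψ₂ with hφ
  have hΨ₂eq' : EqOn Ψ₂ (cayley.symm.trans φ) (ball 0 1) := fun w hw ↦ by
    rw [hΨ₂eq hw]
    change ψ₂ w = ψ₂ (cayley (cayley.symm w))
    rw [cayley.apply_symm_apply hw]
  -- the rotated circle preimage `w t` of `Ω.boundary t` and its real Cayley preimage `g t`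
  set w : ℝ → ℂ := fun t ↦ η⁻¹ * Φ (Ω.boundary t) with hw
  set g : ℝ → ℝ := fun t ↦ (cayleyInvFun (w t)).re with hg
  have hw1 : ∀ t, ‖w t‖ = 1 := fun t ↦ by
    rw [hw]
    simp only [norm_mul, norm_inv, hη1, hΦ1 _ (Ω.boundary_mem_frontier t), inv_one, one_mul]
  have hwne : ∀ t, Ω.boundary t ≠ p₁ → w t ≠ 1 := by
    intro t ht h1
    apply ht
    have h2 : Φ (Ω.boundary t) = η := by
      have : η * w t = η := by rw [h1, mul_one]
      rwa [hw, ← mul_assoc, mul_inv_cancel₀ hη0, one_mul] at this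
    rw [← hΨΦ _ (Ω.boundary_mem_frontier t), h2, hη, hΨΦ _ hp₁f]
  have hcg : ∀ t, Ω.boundary t ≠ p₁ → cayleyFun (g t) = w t := fun t ht ↦ by
    rw [hg, ← cayleyInvFun_eq_ofReal_re (hw1 t), cayleyFun_cayleyInvFun (hwne t ht)]
  have hgc : ∀ t, Ω.boundary t ≠ p₁ → (g t : ℂ) = cayleyInvFun (w t) := fun t _ ↦ by
    rw [hg, ← cayleyInvFun_eq_ofReal_re (hw1 t)]
  have hΨ₂w : ∀ t, Ψ₂ (w t) = Ω.boundary t := fun t ↦ by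
    rw [hΨ₂]
    change Ψ (η * (η⁻¹ * Φ (Ω.boundary t))) = Ω.boundary t
    rw [← mul_assoc, mul_inv_cancel₀ hη0, one_mul, hΨΦ _ (Ω.boundary_mem_frontier t)]
  have hΨ₂g : ∀ t, Ω.boundary t ≠ p₁ → Ψ₂ (cayleyFun (g t)) = Ω.boundary t := fun t ht ↦ by
    rw [hcg t ht, hΨ₂w]
  have hΨ₂1 : Ψ₂ 1 = p₁ := by
    rw [hΨ₂]
    change Ψ (η * 1) = p₁
    rw [mul_one, hη, hΨΦ _ hp₁f]
  refine ⟨φ, g, fun t ht ↦ ?_, fun t ht ↦ ?_, fun s t hs ht hst ↦ ?_, ?_, ?_, ?_⟩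
  · -- (1) boundary value `Ω.boundary t` at `g t`
    have h1 : Tendsto φ (𝓝[upperHalfPlaneSet] (g t : ℂ)) (𝓝 (Ψ₂ (cayleyFun (g t)))) :=
      JordanDomain.tendsto_nhdsWithin_of_extension φ hΨ₂c hΨ₂eq' (by simp)
    rwa [hΨ₂g t ht] at h1
  · -- (2) `φ⁻¹ → g t` at `Ω.boundary t`
    have h1 : φ.HasBoundaryValue (g t) (Ω.boundary t) := by
      have h1 : Tendsto φ (𝓝[upperHalfPlaneSet] (g t : ℂ)) (𝓝 (Ψ₂ (cayleyFun (g t)))) :=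
        JordanDomain.tendsto_nhdsWithin_of_extension φ hΨ₂c hΨ₂eq' (by simp)
      rwa [hΨ₂g t ht] at h1
    exact JordanDomain.tendsto_symm_nhds φ hΨ₂c hΨ₂eq' hΨ₂inj h1
  · -- (3) `g` separates boundary points other than `p₁`
    have h1 : w s = w t := by
      rw [← cayleyFun_cayleyInvFun (hwne s hs), ← cayleyFun_cayleyInvFun (hwne t ht),
        cayleyInvFun_eq_ofReal_re (hw1 s), cayleyInvFun_eq_ofReal_re (hw1 t)]
      exact congrArg (fun r : ℝ ↦ cayleyFun (r : ℂ)) hst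
    rw [← hΨ₂w s, ← hΨ₂w t, h1]
  · -- (4) `|g t| → ∞` as `t → t₁` through parameters with `Ω.boundary t ≠ p₁`
    have hwc : Continuous fun t ↦ w t := by
      have h1 : Continuous fun t ↦ Φ (Ω.boundary t) :=
        hΦc.comp_continuous Ω.continuous_boundary fun t ↦ Ω.boundary_mem_frontier t
      exact continuous_const.mul h1
    have hw₁ : w t₁ = 1 := by
      rw [hw]
      change η⁻¹ * Φ p₁ = 1
      rw [← hη, inv_mul_cancel₀ hη0]
    have h1 : Tendsto w (𝓝[{t | Ω.boundary t ≠ Ω.boundary t₁}] t₁) (𝓝[≠] 1) := by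
      refine tendsto_nhdsWithin_iff.2 ⟨?_, ?_⟩
      · rw [← hw₁]
        exact (hwc.tendsto t₁).mono_left nhdsWithin_le_nhds
      · filter_upwards [self_mem_nhdsWithin] with t ht
        exact hwne t ht
    have h2 : Tendsto (fun t ↦ cayleyInvFun (w t)) (𝓝[{t | Ω.boundary t ≠ Ω.boundary t₁}] t₁)
        (cocompact ℂ) := tendsto_cayleyInvFun_nhdsNE_one.comp h1
    have h3 : Tendsto (fun t ↦ ‖cayleyInvFun (w t)‖)
        (𝓝[{t | Ω.boundary t ≠ Ω.boundary t₁}] t₁) atTop :=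
      tendsto_norm_cocompact_atTop.comp h2
    refine h3.congr' ?_
    filter_upwards [self_mem_nhdsWithin] with t ht
    rw [← hgc t ht, Complex.norm_real, Real.norm_eq_abs]
  · -- (5) `φ → p₁` at infinity
    have := JordanDomain.tendsto_cocompact_of_extension φ hΨ₂c hΨ₂eq'
    rwa [hΨ₂1] at this
  · -- (6) `φ⁻¹ → ∞` at `p₁`
    have h5 : φ.HasBoundaryValueAtInfty p₁ := by
      have := JordanDomain.tendsto_cocompact_of_extension φ hΨ₂c hΨ₂eq'
      rwa [hΨ₂1] at this
    exact JordanDomain.tendsto_symm_cocompact φ hΨ₂c hΨ₂eq' hΨ₂inj h5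

/-! ### Cross-ratio rigidity on an interval: the affine relation -/

/-- `(p - G)/(q - G) → 1` as `|G| → ∞`. [folklore] -/
theorem tendsto_sub_div_sub_of_abs_tendsto_atTop {α : Type*} {l : Filter α} {G : α → ℝ}
    (hG : Tendsto (fun a ↦ |G a|) l atTop) (p q : ℝ) :
    Tendsto (fun a ↦ (p - G a) / (q - G a)) l (𝓝 1) := by
  have h1 : Tendsto (fun a ↦ |q - G a|) l atTop := by
    have h0 : Tendsto (fun a ↦ |G a| + -|q|) l atTop := tendsto_atTop_add_const_right _ _ hG
    refine tendsto_atTop_mono (fun a ↦ ?_) h0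
    have := abs_sub_abs_le_abs_sub (G a) q
    rw [abs_sub_comm] at this
    linarith
  have h2 : Tendsto (fun a ↦ (q - G a)⁻¹) l (𝓝 0) := by
    rw [tendsto_zero_iff_abs_tendsto_zero]
    simpa only [Function.comp_def, abs_inv] using tendsto_inv_atTop_zero.comp h1
  have h3 : Tendsto (fun a ↦ 1 + (p - q) * (q - G a)⁻¹) l (𝓝 (1 + (p - q) * 0)) :=
    tendsto_const_nhds.add (h2.const_mul _)
  rw [mul_zero, add_zero] at h3
  refine h3.congr' ?_
  filter_upwards [h1.eventually (eventually_gt_atTop 0)] with a ha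
  have ha' : q - G a ≠ 0 := abs_pos.1 ha
  field_simp
  ring

/-- Cardy's cross-ratio of the 4-tuple `(u₀, u₁, u₂, u₃)` written with `![…]`. [folklore] -/
theorem crossRatio_vec (f : ℝ → ℝ) (a b c y : ℝ) :
    crossRatio (fun i ↦ f (![a, b, c, y] i)) =
      (f a - f b) / (f a - f c) * ((f c - f y) / (f b - f y)) := by
  simp only [crossRatio, Matrix.cons_val_zero, Matrix.cons_val_one, Matrix.cons_val]
  rw [mul_div_mul_comm]

/-- **The 3-point ratio is preserved.** If `g, g'` have the same cross-ratio on every increasing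
4-tuple of `[0, t₁)` and both are unbounded at `t₁⁻`, then for `0 ≤ a < b < c < t₁`,
`(g a - g b)/(g a - g c) = (g' a - g' b)/(g' a - g' c)` (let the fourth point tend to `t₁`). [folklore] -/
theorem ratio_eq_of_crossRatio_eq {g g' : ℝ → ℝ} {t₁ : ℝ}
    (hcr : ∀ t : Fin 4 → ℝ, StrictMono t → (∀ i, t i ∈ Ico 0 t₁) →
      crossRatio (fun i ↦ g (t i)) = crossRatio (fun i ↦ g' (t i)))
    (hlim : Tendsto (fun t ↦ |g t|) (𝓝[Ico 0 t₁] t₁) atTop)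
    (hlim' : Tendsto (fun t ↦ |g' t|) (𝓝[Ico 0 t₁] t₁) atTop)
    {a b c : ℝ} (ha : 0 ≤ a) (hab : a < b) (hbc : b < c) (hc : c < t₁) :
    (g a - g b) / (g a - g c) = (g' a - g' b) / (g' a - g' c) := by
  have ht₁ : 0 < t₁ := by linarith
  haveI : NeBot (𝓝[Ico 0 t₁] t₁) := by
    refine mem_closure_iff_nhdsWithin_neBot.1 ?_
    rw [closure_Ico ht₁.ne]
    exact right_mem_Icc.2 ht₁.le
  have hev : ∀ᶠ y in 𝓝[Ico 0 t₁] t₁, y ∈ Ico 0 t₁ ∧ c < y := by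
    filter_upwards [self_mem_nhdsWithin, mem_nhdsWithin_of_mem_nhds (Ioi_mem_nhds hc)]
      with y hy hy'
    exact ⟨hy, hy'⟩
  have hL : Tendsto (fun y ↦ crossRatio (fun i ↦ g (![a, b, c, y] i))) (𝓝[Ico 0 t₁] t₁)
      (𝓝 ((g a - g b) / (g a - g c) * 1)) := by
    simp only [crossRatio_vec]
    exact (tendsto_sub_div_sub_of_abs_tendsto_atTop hlim _ _).const_mul _
  have hR : Tendsto (fun y ↦ crossRatio (fun i ↦ g' (![a, b, c, y] i))) (𝓝[Ico 0 t₁] t₁)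
      (𝓝 ((g' a - g' b) / (g' a - g' c) * 1)) := by
    simp only [crossRatio_vec]
    exact (tendsto_sub_div_sub_of_abs_tendsto_atTop hlim' _ _).const_mul _
  rw [mul_one] at hL hR
  refine tendsto_nhds_unique_of_eventuallyEq hL hR ?_
  filter_upwards [hev] with y hy
  have hsm : StrictMono ![a, b, c, y] := by
    refine Fin.strictMono_iff_lt_succ.2 fun i ↦ ?_
    fin_cases i
    · simpa using hab
    · simpa using hbc
    · simpa using hy.2
  have hmem : ∀ i, ![a, b, c, y] i ∈ Ico 0 t₁ := by
    intro i
    fin_cases i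
    · exact ⟨ha, by simp; linarith⟩
    · exact ⟨by simp; linarith, by simp; linarith⟩
    · exact ⟨by simp; linarith, by simp; linarith⟩
    · simpa using hy.1
  exact hcr _ hsm hmem

/-- **Cross-ratio rigidity on an interval (affine form).** Let `g, g' : ℝ → ℝ` be injective on
`[0, t₁)` (`0 < t₁`), unbounded at `t₁⁻`, with the same Cardy cross-ratio on every increasing
4-tuple of `[0, t₁)`. Then `g' = A g + B` on `[0, t₁)` for some real `A ≠ 0`, `B`. (The 3-point
ratio `(x₀ - x₁)/(x₀ - x₂)` is preserved by `ratio_eq_of_crossRatio_eq`; normalise at the two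
points `0` and `t₁ / 2`.) [folklore] -/
theorem affine_of_crossRatio_eq {g g' : ℝ → ℝ} {t₁ : ℝ} (ht₁ : 0 < t₁)
    (hcr : ∀ t : Fin 4 → ℝ, StrictMono t → (∀ i, t i ∈ Ico 0 t₁) →
      crossRatio (fun i ↦ g (t i)) = crossRatio (fun i ↦ g' (t i)))
    (hinj : InjOn g (Ico 0 t₁)) (hinj' : InjOn g' (Ico 0 t₁))
    (hlim : Tendsto (fun t ↦ |g t|) (𝓝[Ico 0 t₁] t₁) atTop)
    (hlim' : Tendsto (fun t ↦ |g' t|) (𝓝[Ico 0 t₁] t₁) atTop) :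
    ∃ A B : ℝ, A ≠ 0 ∧ ∀ t ∈ Ico 0 t₁, g' t = A * g t + B := by
  set c₀ : ℝ := t₁ / 2 with hc₀
  have hc₀0 : 0 < c₀ := by rw [hc₀]; linarith
  have hc₀1 : c₀ < t₁ := by rw [hc₀]; linarith
  have h0m : (0 : ℝ) ∈ Ico 0 t₁ := ⟨le_rfl, ht₁⟩
  have hc₀m : c₀ ∈ Ico 0 t₁ := ⟨hc₀0.le, hc₀1⟩
  have hD : g 0 - g c₀ ≠ 0 := sub_ne_zero.2 fun h ↦ hc₀0.ne (hinj h0m hc₀m h)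
  have hD' : g' 0 - g' c₀ ≠ 0 := sub_ne_zero.2 fun h ↦ hc₀0.ne (hinj' h0m hc₀m h)
  set A : ℝ := (g' 0 - g' c₀) / (g 0 - g c₀) with hA
  have hAD : A * (g 0 - g c₀) = g' 0 - g' c₀ := by rw [hA, div_mul_cancel₀ _ hD]
  refine ⟨A, g' 0 - A * g 0, div_ne_zero hD' hD, fun t ht ↦ ?_⟩
  rcases ht.1.eq_or_lt with rfl | ht0
  · ring
  rcases lt_trichotomy t c₀ with htc | rfl | hct
  · -- `0 < t < c₀`: ratio at `(0, t, c₀)`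
    have h := ratio_eq_of_crossRatio_eq hcr hlim hlim' le_rfl ht0 htc hc₀1
    rw [div_eq_div_iff hD hD'] at h
    -- `h : (g 0 - g t) * (g' 0 - g' c₀) = (g' 0 - g' t) * (g 0 - g c₀)`
    have h2 : (g 0 - g c₀) * (g' 0 - g' t) = (g 0 - g c₀) * (A * (g 0 - g t)) := by
      calc (g 0 - g c₀) * (g' 0 - g' t) = (g 0 - g t) * (g' 0 - g' c₀) := by rw [h]; ring
        _ = (g 0 - g t) * (A * (g 0 - g c₀)) := by rw [hAD]
        _ = (g 0 - g c₀) * (A * (g 0 - g t)) := by ring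
    have h3 : g' 0 - g' t = A * (g 0 - g t) := mul_left_cancel₀ hD h2
    linarith
  · -- `t = c₀`
    linarith
  · -- `c₀ < t < t₁`: ratio at `(0, c₀, t)`
    have hDt : g 0 - g t ≠ 0 := sub_ne_zero.2 fun h ↦ ht0.ne (hinj h0m ht h)
    have hDt' : g' 0 - g' t ≠ 0 := sub_ne_zero.2 fun h ↦ ht0.ne (hinj' h0m ht h)
    have h := ratio_eq_of_crossRatio_eq hcr hlim hlim' le_rfl hc₀0 hct ht.2
    rw [div_eq_div_iff hDt hDt'] at h
    -- `h : (g 0 - g c₀) * (g' 0 - g' t) = (g' 0 - g' c₀) * (g 0 - g t)`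
    rw [← hAD] at h
    have h3 : g' 0 - g' t = A * (g 0 - g t) := by
      have h4 : (g 0 - g c₀) * (g' 0 - g' t) = (g 0 - g c₀) * (A * (g 0 - g t)) := by
        rw [h]; ring
      exact mul_left_cancel₀ hD h4
    linarith

end Literature.Probability.RandomPlanarGeometry
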